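import Mathlib
import HarnessLib
import Literature.MathematicalPhysics.QuantumLattice.GrassmannLinearSubstitution
import Literature.MathematicalPhysics.QuantumLattice.GrassmannKernels

/-!
# Route `KLProgramme` — crux K3, VL child `KLRegimeVolumeLimitV17F2` (stmt-HubbardSuperconductivity-20440), blueprint v5 §1 BASE: THE TRIVIALLY DOUBLED ACTION
# `map (toLin' [1|1]) Y` — kernels, pinned profiles and glued defects read through the first coordinate (seat hubbard-kl-k3c4-p1 g12; `--supports` 20440)

The base of the doubled source-carrying tower is the UV-stepped grid action `Y` (M4a `…TwoVolumeScaleZeroTopFrame`) DOUBLED TRIVIALLY: `Y⁺ := map (toLin' M) Y`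
with the doubled-rows matrix `M (y, c) y′ = [y = y′]` (both copies = the identity; `…TwoVolumeDoubledTowerStep.map_doubleRows_eq_map_doubleBlock_map` with
`A = B = 1` then reads the first re-analysis `[ε•E_plain·S_grid | ε•E_plain·S_grid]` as ONE block substitution of `Y⁺`, the shape of `…TwoVolumeGridSrcSectorScaleSucc`).
This file proves that `Y⁺` carries exactly the data of `Y`:

* **`kernel_map_doubleOne`** — `kernel (map (toLin' M) Y) m X′ = kernel Y m (fst ∘ X′)`;
* `sum_filter_fstPinned_eq` — `Σ_{X′ : (X′ p).1 = y} g (fst ∘ X′) = 2^m · Σ_{X : X p = y} g X`;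
* **`sum_filter_norm_kernel_doubleOne_mul_le`** — every pinned weighted profile of `Y⁺` (weight through `fst`) is `≤ 2^m ×` that of `Y`;
* **`sum_filter_norm_keyedGlued_doubleOne_le`** — for a doubled block structure `ed (x, s) = ((e x).1, ((e x).2, s))` the pinned keyed glued defect of `(Y⁺″, Y⁺)`
  is `≤ 2^m ×` the pinned keyed glued defect of `(Y″, Y)` (block test and residue string commute with `fst`).

Generic; proofs only; no definition (the matrix `M` enters through its defining hypothesis).
-/

noncomputable section

namespace Summit.HubbardSuperconductivity.HubbardSuperconductivity.Theorems.TwoVolumeDefect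

set_option linter.dupNamespace false -- summit = problem name (single-conjunct summit), D-0017

open Finset Literature.MathematicalPhysics.QuantumLattice GrassmannAlgebra

variable {𝕜 : Type*} [RCLike 𝕜]

/-- **Kernels of the trivially doubled action**: `kernel (map (toLin' M) Y) m X′ = kernel Y m (fst ∘ X′)` for `M (y,c) y′ = [y = y′]`. [folklore] -/
theorem kernel_map_doubleOne {Γ : Type*} [Fintype Γ] [DecidableEq Γ] (M : Matrix (Γ × Fin 2) Γ 𝕜) (hM : ∀ p y, M p y = if p.1 = y then 1 else 0)
    (Y : GrassmannAlgebra 𝕜 Γ) (m : ℕ) (X' : Fin m → Γ × Fin 2) :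
    kernel 𝕜 (ExteriorAlgebra.map (Matrix.toLin' M) Y) m X' = kernel 𝕜 Y m (fun i => (X' i).1) := by
  classical
  rw [kernel_map]
  rw [Finset.sum_eq_single (fun i => (X' i).1)]
  · simp [hM]
  · intro X _ hX
    obtain ⟨i, hi⟩ : ∃ i, X i ≠ (X' i).1 := by by_contra h; push Not at h; exact hX (funext h)
    rw [Finset.prod_eq_zero (Finset.mem_univ i) (by rw [LinearMap.toMatrix'_toLin', hM, if_neg (Ne.symm hi)]), zero_mul]
  · intro h; exact absurd (Finset.mem_univ _) h

/-- **Strings of doubled legs pinned through the first coordinate**: `Σ_{X′ : (X′ p).1 = y} g (fst ∘ X′) = 2^m · Σ_{X : X p = y} g X`. [folklore] -/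
theorem sum_filter_fstPinned_eq {Γ : Type*} [Fintype Γ] [DecidableEq Γ] (m : ℕ) (p : Fin m) (y : Γ) (g : (Fin m → Γ) → ℝ) :
    ∑ X' ∈ univ.filter (fun X' : Fin m → Γ × Fin 2 => (X' p).1 = y), g (fun i => (X' i).1) =
      2 ^ m * ∑ X ∈ univ.filter (fun X : Fin m → Γ => X p = y), g X := by
  classical
  -- split a doubled string into its site string and its copy string
  have hsplit : ∑ X' ∈ univ.filter (fun X' : Fin m → Γ × Fin 2 => (X' p).1 = y), g (fun i => (X' i).1) =
      ∑ q ∈ (univ.filter (fun X : Fin m → Γ => X p = y)) ×ˢ (univ : Finset (Fin m → Fin 2)), g q.1 := by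
    refine Finset.sum_nbij' (fun X' => (fun i => (X' i).1, fun i => (X' i).2)) (fun q => fun i => (q.1 i, q.2 i)) ?_ ?_ ?_ ?_ ?_
    · intro X' hX'; simp only [mem_filter, mem_univ, true_and] at hX'; simp [hX']
    · intro q hq; simp only [mem_product, mem_filter, mem_univ, true_and, and_true] at hq; simp [hq]
    · intro X' _; funext i; simp
    · intro q _; rcases q with ⟨a, c⟩; rfl
    · intro X' _; rfl
  rw [hsplit, sum_product, sum_comm]
  simp only [sum_const, card_univ, Fintype.card_fun, Fintype.card_fin, nsmul_eq_mul]
  push_cast; ring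

/-- **Pinned weighted profiles of the trivially doubled action** (weight read through `fst`): `≤ 2^m ×` those of `Y`. [folklore] -/
theorem sum_filter_norm_kernel_doubleOne_mul_le {Γ : Type*} [Fintype Γ] [DecidableEq Γ] (M : Matrix (Γ × Fin 2) Γ 𝕜)
    (hM : ∀ p y, M p y = if p.1 = y then 1 else 0) (Y : GrassmannAlgebra 𝕜 Γ) (m : ℕ) (p : Fin m) (w : Γ × Fin 2)
    (wt : (Fin m → Γ) → ℝ) (hwt : ∀ X, 0 ≤ wt X) {N : ℝ}
    (hN : ∑ X ∈ univ.filter (fun X : Fin m → Γ => X p = w.1), ‖kernel 𝕜 Y m X‖ * wt X ≤ N) :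
    ∑ X' ∈ univ.filter (fun X' : Fin m → Γ × Fin 2 => X' p = w), ‖kernel 𝕜 (ExteriorAlgebra.map (Matrix.toLin' M) Y) m X'‖ * wt (fun i => (X' i).1) ≤
      2 ^ m * N := by
  classical
  simp only [kernel_map_doubleOne M hM]
  calc ∑ X' ∈ univ.filter (fun X' : Fin m → Γ × Fin 2 => X' p = w), ‖kernel 𝕜 Y m (fun i => (X' i).1)‖ * wt (fun i => (X' i).1)
      ≤ ∑ X' ∈ univ.filter (fun X' : Fin m → Γ × Fin 2 => (X' p).1 = w.1), ‖kernel 𝕜 Y m (fun i => (X' i).1)‖ * wt (fun i => (X' i).1) :=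
        sum_le_sum_of_subset_of_nonneg (fun X' hX' => by
          simp only [mem_filter, mem_univ, true_and] at hX' ⊢; rw [hX']) fun X' _ _ => mul_nonneg (norm_nonneg _) (hwt _)
    _ = 2 ^ m * ∑ X ∈ univ.filter (fun X : Fin m → Γ => X p = w.1), ‖kernel 𝕜 Y m X‖ * wt X :=
        sum_filter_fstPinned_eq m p w.1 (fun X => ‖kernel 𝕜 Y m X‖ * wt X)
    _ ≤ 2 ^ m * N := mul_le_mul_of_nonneg_left hN (pow_nonneg (by norm_num) m)

/-- **Pinned keyed glued defects of the trivially doubled pair** `(Y⁺″, Y⁺)` under a doubled block structure `ed (x, s) = ((e x).1, ((e x).2, s))`: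
`≤ 2^m ×` the pinned keyed glued defect of `(Y″, Y)` (the block test and the residue string only see the first coordinate). [folklore] -/
theorem sum_filter_norm_keyedGlued_doubleOne_le {ι Γ Γ' : Type*} [Fintype Γ] [DecidableEq Γ] [Fintype Γ'] [DecidableEq Γ'] [DecidableEq ι]
    (e : Γ' ≃ ι × Γ) (ed : (Γ' × Fin 2) ≃ ι × (Γ × Fin 2)) (hed : ∀ x s, ed (x, s) = ((e x).1, ((e x).2, s)))
    (M : Matrix (Γ × Fin 2) Γ 𝕜) (hM : ∀ p y, M p y = if p.1 = y then 1 else 0)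
    (M' : Matrix (Γ' × Fin 2) Γ' 𝕜) (hM' : ∀ p y, M' p y = if p.1 = y then 1 else 0)
    (Y : GrassmannAlgebra 𝕜 Γ) (Y'' : GrassmannAlgebra 𝕜 Γ') (m : ℕ) (p : Fin m) (w : Γ' × Fin 2) {E : ℝ}
    (hE : ∑ X ∈ univ.filter (fun X : Fin m → Γ' => X p = w.1),
      ‖kernel 𝕜 Y'' m X - (if ∀ i, (e (X i)).1 = (e (X p)).1 then kernel 𝕜 Y m (fun i => (e (X i)).2) else 0)‖ ≤ E) :
    ∑ X' ∈ univ.filter (fun X' : Fin m → Γ' × Fin 2 => X' p = w),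
        ‖kernel 𝕜 (ExteriorAlgebra.map (Matrix.toLin' M') Y'') m X' -
          (if ∀ i, (ed (X' i)).1 = (ed (X' p)).1 then kernel 𝕜 (ExteriorAlgebra.map (Matrix.toLin' M) Y) m (fun i => (ed (X' i)).2) else 0)‖ ≤ 2 ^ m * E := by
  classical
  have hed1 : ∀ q : Γ' × Fin 2, (ed q).1 = (e q.1).1 := fun q => by obtain ⟨x, s⟩ := q; rw [hed]
  have hed2 : ∀ q : Γ' × Fin 2, (ed q).2 = ((e q.1).2, q.2) := fun q => by obtain ⟨x, s⟩ := q; rw [hed]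
  have hE0 : 0 ≤ E := le_trans (sum_nonneg fun _ _ => norm_nonneg _) hE
  -- read every term through `fst`
  have hterm : ∀ X' : Fin m → Γ' × Fin 2,
      ‖kernel 𝕜 (ExteriorAlgebra.map (Matrix.toLin' M') Y'') m X' -
          (if ∀ i, (ed (X' i)).1 = (ed (X' p)).1 then kernel 𝕜 (ExteriorAlgebra.map (Matrix.toLin' M) Y) m (fun i => (ed (X' i)).2) else 0)‖ =
        (fun X : Fin m → Γ' => ‖kernel 𝕜 Y'' m X - (if ∀ i, (e (X i)).1 = (e (X p)).1 then kernel 𝕜 Y m (fun i => (e (X i)).2) else 0)‖)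
          (fun i => (X' i).1) := by
    intro X'
    simp only [kernel_map_doubleOne M' hM', kernel_map_doubleOne M hM, hed1, hed2]
  simp only [hterm]
  calc ∑ X' ∈ univ.filter (fun X' : Fin m → Γ' × Fin 2 => X' p = w),
          (fun X : Fin m → Γ' => ‖kernel 𝕜 Y'' m X - (if ∀ i, (e (X i)).1 = (e (X p)).1 then kernel 𝕜 Y m (fun i => (e (X i)).2) else 0)‖)
            (fun i => (X' i).1)
      ≤ ∑ X' ∈ univ.filter (fun X' : Fin m → Γ' × Fin 2 => (X' p).1 = w.1),
          (fun X : Fin m → Γ' => ‖kernel 𝕜 Y'' m X - (if ∀ i, (e (X i)).1 = (e (X p)).1 then kernel 𝕜 Y m (fun i => (e (X i)).2) else 0)‖)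
            (fun i => (X' i).1) :=
        sum_le_sum_of_subset_of_nonneg (fun X' hX' => by
          simp only [mem_filter, mem_univ, true_and] at hX' ⊢; rw [hX']) fun _ _ _ => norm_nonneg _
    _ = 2 ^ m * ∑ X ∈ univ.filter (fun X : Fin m → Γ' => X p = w.1),
          ‖kernel 𝕜 Y'' m X - (if ∀ i, (e (X i)).1 = (e (X p)).1 then kernel 𝕜 Y m (fun i => (e (X i)).2) else 0)‖ :=
        sum_filter_fstPinned_eq m p w.1
          (fun X : Fin m → Γ' => ‖kernel 𝕜 Y'' m X - (if ∀ i, (e (X i)).1 = (e (X p)).1 then kernel 𝕜 Y m (fun i => (e (X i)).2) else 0)‖)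
    _ ≤ 2 ^ m * E := mul_le_mul_of_nonneg_left hE (pow_nonneg (by norm_num) m)

end Summit.HubbardSuperconductivity.HubbardSuperconductivity.Theorems.TwoVolumeDefect

end
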